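import Summits.HodgeConjecture.HodgeConjecture.Theorems.Ring2WeilCoverageRealGeneratorTypes
import Summits.HodgeConjecture.HodgeConjecture.Theorems.Ring2WeilCoverageCyclotomicSignaturesG10
import Summits.HodgeConjecture.HodgeConjecture.Theorems.Ring2WeilCoverageCyclotomicUnconditionalSqrtNegEleven
import Summits.HodgeConjecture.HodgeConjecture.Theorems.Ring2WeilCoverageResidueDictionaryRowsB
import HarnessLib

/-!
# Weil-type family coverage — THE QUADRATIC-SURD TYPE AT LEVEL `44` (`g = 10`): every `ℚ(√−11)`-balanced CM type of `ℚ(ζ₄₄)` (the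
# NO row `(44, √−11)`) carries a polarisation of type `(2 + √11)` — the prime of `ℚ(ζ₄₄)⁺` over the unramified inert prime `7` —
# of degree `7⁵`, whose polarised CM points lie on the NON-SPLIT tenfold row `(5, ℚ(√−11), 7)` (S-pencil); the `ℚ(i)`-balanced
# types do not

research route conditional on HC_CM; not a corollary; Q11.4-sentence-2 already refuted in dim ≥ 3.

Ring 2, WEIL-TYPE FAMILY-COVERAGE CENSUS (`HOME/WEIL-FAMILY-COVERAGE.md` `## b01`, blocks b01.8.3 (the `g = 10` table, rows `W10.11.a`),
b01.34 (the NO row `(44, √−11)`), b01.41; owner ring2-b01), part 54e of the `Ring2WeilCoverage*` series (part 53's engine; 54a–c =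
levels 21, 28, 36).  `ℚ(ζ₄₄)⁺ ∋ θ₁₁ = ζ¹¹(1 + 2(ζ⁴ + ζ¹² + ζ¹⁶ + ζ²⁰ + ζ³⁶))`, `θ₁₁² = 11`, real (part 31).  `7` has order `10` mod `44`
with `7⁵ ≡ −1`: the prime of `ℚ(ζ₄₄)⁺` above `7` is INERT in `ℚ(ζ₄₄)` and principal with the surd generator `ϖ₇ = 2 + θ₁₁` of norm
`4 − 11 = −7 < 0` — so `|A_ϖ|/2 = 5` is odd and the principal verdict FLIPS (parts 48/53):

* `re_sqrtEleven` (**sign dictionary of `√11 ∈ ℚ(ζ₄₄)⁺`**: `Re σ_t(θ₁₁) < 0 ↔ t ∈ {1, 5, 7, 9, 19, 25, 35, 37, 39, 43}` — where the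
  signs of `Im σ_t(i)` and of the Gauss sum `σ_t(1 + 2Σ_{QR} η^a)` (parts 26/26b/27b) agree; `(Re σ_t θ₁₁)² = 11`, `Im = 0`);
* `signSet_fortyFour_seven` (`ϖ₇ = 2 + θ₁₁`; real, non-zero), `twistSetA_fortyFour` (`X = N_odd ∆ A =
  {7, 15, 23, 25, 27, 31, 35, 39, 41, 43}`, `decide`), `span_mul_span_fortyFour_seven` (`(ϖ₇)(ϖ₇′) = (7)` in `𝓞 K`: `N(𝔣₀) = 7⁵`);
* **`exists_type_fortyFour_seven_sqrt_neg_eleven`** (EVERY `ℚ(√−11)`-balanced `Φ`, every `𝔣₀` with `𝔬𝔣₀ = (ϖ₇)`: a `Φ`-positive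
  divisor of type `(K; Φ; 𝔣₀)` on `ℂ^Φ/Φ(ℤ[ζ₄₄])`; `|S_Φ ∩ X| ≡ 5 + 5`), headline **`exists_surdType_fortyFour_seven_sqrt_neg_eleven`**,
  `not_exists_type_fortyFour_seven_sqrt_neg_one` (the YES row: `|S_Φ ∩ X| ≡ 2 + 5`).

COMPONENTS (S-pencil, exact hermitian determinants, `g61/py/component_surd.py`): on the `(44, √−11)`-balanced `ℤ[ζ₄₄]`-tori the type
`(2 + √11)` has `a = 7⁵ ≡ 7`, `T(a) = {7, 11}` — **the NON-split tenfold row `(5, ℚ(√−11), 7)`**, for all 252 such CM types, each with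
an explicit `𝒪_L`-linear polarisation of degree `16807`; on the `ℚ(i)`-balanced tori `a = −7⁵ < 0` (no polarisation, as proved).

HONEST FRAMING: torus-level statements about Shimura's divisors of type `(K; Φ; 𝔣₀)` on `ℂ^Φ/Φ(ℤ[ζ₄₄])` [Sh98 §14.3 Prop. 4–5],
elementary arithmetic of `ℤ[ζ₄₄]` and residue combinatorics (`decide`); the component statement is S-pencil (docstring
only); nothing here is a statement about Hodge classes, `W_K`, general members or HC; `HC_CM` is used nowhere.  No `def`, no
named fact, no `sorry`.

References: [cite: Shimura1998, §14.3 Prop. 4–5, pp. 103–104]; [cite: vanGeemen1994HodgeAV, Lemma 5.2, Thm. 5.10];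
[cite: Washington1997, Lemma 4.8]; census b01.8.3 / b01.41 (seat-derived).
-/

noncomputable section

open Polynomial NumberField Complex Finset
open scoped Real nonZeroDivisors

namespace Summit.HodgeConjecture.Ring2WeilCoverage.SurdTypesLevel44

open Literature.AlgebraicGeometry.Motives (CMType)
open Literature.AlgebraicGeometry.HodgeTheory (IsCMTypeSet)
open Literature.AlgebraicGeometry.ComplexMultiplication.CyclotomicCMType (isCMTypeSet_residueFilter exists_apply_eq_toCircle)
open Literature.NumberTheory.ComplexMultiplication
open Summit.HodgeConjecture.Ring2WeilCoverage.RealGeneratorTypes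
open Summit.HodgeConjecture.Ring2WeilCoverage.RamifiedTypes (card_inter_mod_two_eq)
open Summit.HodgeConjecture.Ring2WeilCoverage.CyclotomicPrincipalObstruction (coprime_of_apply_eq_toCircle)
open Summit.HodgeConjecture.Ring2WeilCoverage.CMTypeSetOddPositions (two_mul_card_eq_card_units)
open Summit.HodgeConjecture.Ring2WeilCoverage.CyclotomicSignaturesG10 (exists_units_sign_eq_fortyFour)
open Summit.HodgeConjecture.Ring2WeilCoverage.CyclotomicUnconditionalSqrtNegEleven
  (sq_sqrtEleven complexConj_sqrtEleven norm_realUnits_pos_fortyFour)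
open Summit.HodgeConjecture.Ring2WeilCoverage.ResidueDictionaryPieces (im_embedding_sqrtNegOne_neg_iff)
open Summit.HodgeConjecture.Ring2WeilCoverage.ResidueDictionaryPiecesB (im_embedding_sqrtNegEleven_neg_iff)
open Summit.HodgeConjecture.Ring2WeilCoverage.ResidueDictionaryRowsB (nK_fortyFour_sqrt_neg_one nK_fortyFour_sqrt_neg_eleven)

variable {K : Type} [Field K] [NumberField K] {ζ : K}

/-- `𝐞(t) = exp(2πi t/n) ∈ ℂ` (`ZMod.toCircle`). -/
local notation3 (prettyPrint := false) "𝐞 " t:max => ((ZMod.toCircle t : Circle) : ℂ)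

/-- the residue set `S_Φ` read at level `44`. -/
local notation3 (prettyPrint := false) "SΦ[" Φ "," z "]" =>
  (Finset.univ.filter fun t : ZMod 44 => ∃ σ ∈ (Φ : CMType K).1, σ (z : K) = 𝐞 t)

/-- part 53's twisted set `X_A` at level `44`. -/
local notation3 (prettyPrint := false) "XA44 " A:max =>
  (Finset.univ.filter fun t : ZMod 44 => t.val.Coprime 44 ∧
    ¬ (t ∈ (A : Finset (ZMod 44)) ↔ Even (Finset.card (Finset.filter (fun s : ZMod 44 => s.val.Coprime 44 ∧ s.val < t.val) Finset.univ))))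

/-- the Gauss sum `g₁₁ = 1 + 2(ζ⁴ + ζ¹² + ζ¹⁶ + ζ²⁰ + ζ³⁶)` (`g₁₁² = −11`, `η = ζ⁴`). -/
local notation3 (prettyPrint := false) "g11[" z "]" =>
  (1 + 2 * ((z : K) ^ 4 + (z : K) ^ 12 + (z : K) ^ 16 + (z : K) ^ 20 + (z : K) ^ 36))

/-- `θ₁₁ = ζ¹¹ · g₁₁` (`θ₁₁² = 11`, real; part 31). -/
local notation3 (prettyPrint := false) "θ11[" z "]" =>
  ((z : K) ^ 11 * (1 + 2 * ((z : K) ^ 4 + (z : K) ^ 12 + (z : K) ^ 16 + (z : K) ^ 20 + (z : K) ^ 36)))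

omit [NumberField K] in
/-- `θ₁₁² = 11` (part 31's `sq_sqrtEleven`, powers normalised). [folklore] -/
theorem sq_sqrtEleven' (hζ : IsPrimitiveRoot ζ 44) : (θ11[ζ]) ^ 2 = (11 : K) := by
  have h := sq_sqrtEleven hζ
  simp only [← pow_mul, Nat.reduceMul] at h
  exact h

/-- `θ₁₁` is real (part 31's `complexConj_sqrtEleven`, powers normalised). [folklore] -/
theorem complexConj_sqrtEleven' [IsCMField K] (hζ : IsPrimitiveRoot ζ 44) :
    IsCMField.complexConj K (θ11[ζ]) = θ11[ζ] := by
  have h := complexConj_sqrtEleven hζ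
  simp only [← pow_mul, Nat.reduceMul] at h
  exact h

omit [NumberField K] in
/-- **The sign dictionary of `√11 ∈ ℚ(ζ₄₄)⁺`**: for `φ ζ = 𝐞(t)`, `Re φ(θ₁₁) < 0 ↔ t ∈ {1, 5, 7, 9, 19, 25, 35, 37, 39, 43}`
(`θ₁₁ = σ_t(i) · i√11·ε₁₁(t)` is negative where the signs of `Im σ_t(ζ¹¹)` and of the Gauss sum agree), `(Re φ θ₁₁)² = 11`,
`Im φ θ₁₁ = 0`.
research route conditional on HC_CM; not a corollary; Q11.4-sentence-2 already refuted in dim ≥ 3. [cite: Washington1997, Lemma 4.8] -/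
theorem re_sqrtEleven (hζ : IsPrimitiveRoot ζ 44) {φ : K →+* ℂ} {t : ZMod 44} (hφt : φ ζ = 𝐞 t) :
    ((φ (θ11[ζ])).re < 0 ↔ t ∈ ({1, 5, 7, 9, 19, 25, 35, 37, 39, 43} : Finset (ZMod 44))) ∧ (φ (θ11[ζ])).re ^ 2 = 11 ∧
      (φ (θ11[ζ])).im = 0 := by
  have ht := coprime_of_apply_eq_toCircle hζ hφt
  have k1 := im_embedding_sqrtNegOne_neg_iff (K := K) (n := 44) (by norm_num) hφt ht
  have k7 := im_embedding_sqrtNegEleven_neg_iff (K := K) (n := 44) (by norm_num) hφt ht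
  simp only [Nat.reduceDiv, Nat.reduceMul] at k1 k7
  have i1 := nK_fortyFour_sqrt_neg_one hφt ht
  have i7 := nK_fortyFour_sqrt_neg_eleven hφt ht
  have him : (φ (θ11[ζ])).im = 0 := by rw [map_mul, Complex.mul_im, k1.2, k7.2]; ring
  have hre : (φ (θ11[ζ])).re = -((φ (ζ ^ 11)).im * (φ (g11[ζ])).im) := by
    rw [map_mul, Complex.mul_re, k1.2, k7.2]; ring
  have y : (φ (θ11[ζ])).re ^ 2 = 11 := by
    have s := congrArg Complex.re (congrArg φ (sq_sqrtEleven' hζ))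
    rw [map_pow, map_ofNat, pow_two, Complex.mul_re, him] at s
    simp only [mul_zero, sub_zero, Complex.re_ofNat] at s
    rw [pow_two]; exact s
  have hdec : ∀ s : ZMod 44, s.val.Coprime 44 →
      ((s ∈ ({3, 7, 15, 19, 23, 27, 31, 35, 39, 43} : Finset (ZMod 44)) ↔
          s ∈ ({7, 13, 17, 19, 21, 29, 35, 39, 41, 43} : Finset (ZMod 44))) ↔
        s ∈ ({1, 5, 7, 9, 19, 25, 35, 37, 39, 43} : Finset (ZMod 44))) := by
    decide
  refine ⟨?_, y, him⟩
  rw [hre, neg_lt_zero, ← hdec t ht, ← i1, ← i7]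
  set a := (φ (ζ ^ 11)).im with ha
  set b := (φ (g11[ζ])).im with hb
  have ha0 : a ≠ 0 := k1.1.2
  have hb0 : b ≠ 0 := k7.1.2
  rcases lt_or_gt_of_ne ha0 with h1 | h1 <;> rcases lt_or_gt_of_ne hb0 with h2 | h2
  · exact ⟨fun _ => ⟨fun _ => h2, fun _ => h1⟩, fun _ => mul_pos_of_neg_of_neg h1 h2⟩
  · exact ⟨fun h => absurd h (not_lt.mpr (mul_nonpos_of_nonpos_of_nonneg h1.le h2.le)),
      fun h => absurd (h.mp h1) (not_lt.mpr h2.le)⟩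
  · exact ⟨fun h => absurd h (not_lt.mpr (mul_nonpos_of_nonneg_of_nonpos h1.le h2.le)),
      fun h => absurd (h.mpr h2) (not_lt.mpr h1.le)⟩
  · exact ⟨fun _ => ⟨fun h => absurd h (not_lt.mpr h1.le), fun h => absurd h (not_lt.mpr h2.le)⟩, fun _ => mul_pos h1 h2⟩

/-- **`ϖ₇ = 2 + θ₁₁` (a generator of a prime of `ℚ(ζ₄₄)⁺` over `7`, inert in `ℚ(ζ₄₄)`):
`Re φ(ϖ₇) < 0 ↔ t ∈ {1, 5, 7, 9, 19, 25, 35, 37, 39, 43}`** (`√11 > 2`); `ϖ₇` real, non-zero.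
research route conditional on HC_CM; not a corollary; Q11.4-sentence-2 already refuted in dim ≥ 3. [folklore] -/
theorem signSet_fortyFour_seven [IsCMField K] (hζ : IsPrimitiveRoot ζ 44) :
    (∀ (φ : K →+* ℂ) (t : ZMod 44), φ ζ = 𝐞 t →
      ((φ (2 + θ11[ζ])).re < 0 ↔ t ∈ ({1, 5, 7, 9, 19, 25, 35, 37, 39, 43} : Finset (ZMod 44)))) ∧
    IsCMField.complexConj K (2 + θ11[ζ]) = 2 + θ11[ζ] ∧ (2 + θ11[ζ]) ≠ 0 := by
  have key : ∀ r : ℝ, r ^ 2 = 11 → ((2 + r < 0 ↔ r < 0) ∧ 2 + r ≠ 0) := fun r hr =>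
    ⟨⟨fun h => by nlinarith, fun h => by nlinarith⟩, fun h => by nlinarith⟩
  refine ⟨fun φ t hφt => ?_, by rw [map_add, map_ofNat, complexConj_sqrtEleven' hζ], fun h0 => ?_⟩
  · obtain ⟨hiff, hsq, -⟩ := re_sqrtEleven hζ hφt
    rw [map_add, Complex.add_re, map_ofNat, show ((2 : ℂ)).re = 2 by norm_num, ← hiff]
    exact (key _ hsq).1
  · obtain ⟨φ⟩ := (inferInstance : Nonempty (K →+* ℂ))
    obtain ⟨t, -, hφt⟩ := exists_apply_eq_toCircle hζ φ
    obtain ⟨-, hsq, -⟩ := re_sqrtEleven hζ hφt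
    apply (key _ hsq).2
    have := congrArg Complex.re (congrArg φ h0)
    rw [map_add, map_zero, Complex.add_re, map_ofNat] at this
    simpa using this

/-- **`X_A = N_odd ∆ A = {7, 15, 23, 25, 27, 31, 35, 39, 41, 43}` at level `44`** for `A = {1, 5, 7, 9, 19, 25, 35, 37, 39, 43}`
(`decide`; `|N_odd ∖ X| = 5`: the flip).
research route conditional on HC_CM; not a corollary; Q11.4-sentence-2 already refuted in dim ≥ 3. [folklore] -/
theorem twistSetA_fortyFour :
    XA44 ({1, 5, 7, 9, 19, 25, 35, 37, 39, 43} : Finset (ZMod 44)) =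
      ({7, 15, 23, 25, 27, 31, 35, 39, 41, 43} : Finset (ZMod 44)) := by
  decide

omit [NumberField K] in
/-- The integer `2 + Θ₁₁` of `𝓞 K` coerces to `ϖ₇`. [folklore] -/
theorem coe_surd_fortyFour (hζ : IsPrimitiveRoot ζ 44) :
    (((2 + hζ.toInteger ^ 11 * (1 + 2 * (hζ.toInteger ^ 4 + hζ.toInteger ^ 12 + hζ.toInteger ^ 16 +
      hζ.toInteger ^ 20 + hζ.toInteger ^ 36)) : 𝓞 K)) : K) = 2 + θ11[ζ] := by
  push_cast
  rfl

omit [NumberField K] in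
/-- **`(ϖ₇)·(ϖ₇′) = (7)`** in `𝓞 K`, `ϖ₇′ = 2 − θ₁₁` (`4 − 11 = −7`; `N(𝔣₀) = 7⁵`: degree `16807`, elementary divisors
`(1,1,1,1,1,7,7,7,7,7)`).
research route conditional on HC_CM; not a corollary; Q11.4-sentence-2 already refuted in dim ≥ 3. [folklore] -/
theorem span_mul_span_fortyFour_seven (hζ : IsPrimitiveRoot ζ 44) :
    Ideal.span {(2 + hζ.toInteger ^ 11 * (1 + 2 * (hζ.toInteger ^ 4 + hζ.toInteger ^ 12 + hζ.toInteger ^ 16 +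
        hζ.toInteger ^ 20 + hζ.toInteger ^ 36)) : 𝓞 K)} *
      Ideal.span {(2 - hζ.toInteger ^ 11 * (1 + 2 * (hζ.toInteger ^ 4 + hζ.toInteger ^ 12 + hζ.toInteger ^ 16 +
        hζ.toInteger ^ 20 + hζ.toInteger ^ 36)) : 𝓞 K)} =
      Ideal.span {(7 : 𝓞 K)} := by
  have hzK : algebraMap (𝓞 K) K hζ.toInteger = ζ := rfl
  rw [Ideal.span_singleton_mul_span_singleton, ← Ideal.span_singleton_neg (7 : 𝓞 K)]
  congr 2
  apply RingOfIntegers.ext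
  push_cast; simp only [hzK, map_ofNat]
  linear_combination (-1 : K) * sq_sqrtEleven' hζ

open scoped Classical in
/-- **ROW `(ℚ(ζ₄₄), ℚ(√−11))` — THE TYPE `(2 + √11)` EXISTS** (→ `(5, ℚ(√−11), 7)`, degree `7⁵`, S-pencil): for every CM type `Φ`
balanced for `N_K = {7, 13, 17, 19, 21, 29, 35, 39, 41, 43}` and every `𝔣₀` with `𝔬𝔣₀ = (ϖ₇)`, a `Φ`-positive divisor of type
`(K; Φ; 𝔣₀)` on `ℂ^Φ/Φ(ℤ[ζ₄₄])` (`|S_Φ ∩ X| ≡ |X ∖ N_K| + 5 = 5 + 5`).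
research route conditional on HC_CM; not a corollary; Q11.4-sentence-2 already refuted in dim ≥ 3. [cite: Shimura1998, §14.3 Prop. 4–5, pp. 103–104] -/
theorem exists_type_fortyFour_seven_sqrt_neg_eleven [IsCMField K] [IsCyclotomicExtension {44} ℚ K]
    (hζ : IsPrimitiveRoot ζ 44) (Φ : CMType K)
    (hbal : 2 * (SΦ[Φ, ζ] ∩ ({7, 13, 17, 19, 21, 29, 35, 39, 41, 43} : Finset (ZMod 44))).card = (SΦ[Φ, ζ]).card)
    {𝔣₀ : Ideal (𝓞 (maximalRealSubfield K))}
    (h𝔣₀ : 𝔣₀.map (algebraMap (𝓞 (maximalRealSubfield K)) (𝓞 K)) =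
      Ideal.span {(2 + hζ.toInteger ^ 11 * (1 + 2 * (hζ.toInteger ^ 4 + hζ.toInteger ^ 12 + hζ.toInteger ^ 16 +
        hζ.toInteger ^ 20 + hζ.toInteger ^ 36)) : 𝓞 K)}) :
    ∃ ζ' : K, IsCMField.complexConj K ζ' = -ζ' ∧ (∀ φ : Φ.1, 0 < (φ.1 ζ').im) ∧
        CMTypeLattice.IsOfType (1 : (FractionalIdeal (𝓞 K)⁰ K)ˣ) ζ' 𝔣₀ := by
  have hg : Nat.totient 44 = 2 * (9 + 1) := by decide
  obtain ⟨hA, hreal, h0⟩ := signSet_fortyFour_seven hζ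
  refine exists_type_of_even' hζ hg hreal h0 (coe_surd_fortyFour hζ) hA Φ h𝔣₀ (exists_units_sign_eq_fortyFour hζ Φ) ?_
  rw [twistSetA_fortyFour]
  have hS := isCMTypeSet_residueFilter hζ Φ
  have hX : IsCMTypeSet 44 ({7, 15, 23, 25, 27, 31, 35, 39, 41, 43} : Finset (ZMod 44)) := by decide
  have hNK : IsCMTypeSet 44 ({7, 13, 17, 19, 21, 29, 35, 39, 41, 43} : Finset (ZMod 44)) := by decide
  have h1 := card_inter_mod_two_eq hS hX hNK
  have h2 := two_mul_card_eq_card_units hS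
  have hU : (Finset.univ.filter fun t : ZMod 44 => t.val.Coprime 44).card = 20 := by decide
  have h3 : (({7, 15, 23, 25, 27, 31, 35, 39, 41, 43} : Finset (ZMod 44)) \
      ({7, 13, 17, 19, 21, 29, 35, 39, 41, 43} : Finset (ZMod 44))).card = 5 := by decide
  rw [Nat.even_iff]
  omega

open scoped Classical in
/-- **ROW `(ℚ(ζ₄₄), ℚ(√−11))`, headline: `∃ 𝔣₀`, `𝔬𝔣₀·(2 − θ₁₁) = (7)`, and a `Φ`-positive divisor of type `(K; Φ; 𝔣₀)` on
`ℂ^Φ/Φ(ℤ[ζ₄₄])`** for every `ℚ(√−11)`-balanced CM type `Φ` (degree `7⁵`; S-pencil: on `(5, ℚ(√−11), 7)`).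
research route conditional on HC_CM; not a corollary; Q11.4-sentence-2 already refuted in dim ≥ 3. [cite: Shimura1998, §14.3 Prop. 4–5, pp. 103–104] -/
theorem exists_surdType_fortyFour_seven_sqrt_neg_eleven [IsCMField K] [IsCyclotomicExtension {44} ℚ K]
    (hζ : IsPrimitiveRoot ζ 44) (Φ : CMType K)
    (hbal : 2 * (SΦ[Φ, ζ] ∩ ({7, 13, 17, 19, 21, 29, 35, 39, 41, 43} : Finset (ZMod 44))).card = (SΦ[Φ, ζ]).card) :
    ∃ 𝔣₀ : Ideal (𝓞 (maximalRealSubfield K)),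
      𝔣₀.map (algebraMap (𝓞 (maximalRealSubfield K)) (𝓞 K)) *
          Ideal.span {(2 - hζ.toInteger ^ 11 * (1 + 2 * (hζ.toInteger ^ 4 + hζ.toInteger ^ 12 + hζ.toInteger ^ 16 +
            hζ.toInteger ^ 20 + hζ.toInteger ^ 36)) : 𝓞 K)} = Ideal.span {(7 : 𝓞 K)} ∧
      ∃ ζ' : K, IsCMField.complexConj K ζ' = -ζ' ∧ (∀ φ : Φ.1, 0 < (φ.1 ζ').im) ∧
        CMTypeLattice.IsOfType (1 : (FractionalIdeal (𝓞 K)⁰ K)ˣ) ζ' 𝔣₀ := by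
  obtain ⟨-, hreal, -⟩ := signSet_fortyFour_seven hζ
  obtain ⟨𝔣₀, h𝔣₀⟩ := exists_ideal_map_eq_span (coe_surd_fortyFour hζ) hreal
  exact ⟨𝔣₀, by rw [h𝔣₀]; exact span_mul_span_fortyFour_seven hζ,
    exists_type_fortyFour_seven_sqrt_neg_eleven hζ Φ hbal h𝔣₀⟩

open scoped Classical in
/-- **Row `(ℚ(ζ₄₄), ℚ(i))` (YES for principal) does NOT carry the type `(2 + √11)`** (`N_K = {3, 7, 15, 19, 23, 27, 31, 35, 39, 43}`;
THEOREM L (i) at 44 + `|S_Φ ∩ X| ≡ 2 + 5`).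
research route conditional on HC_CM; not a corollary; Q11.4-sentence-2 already refuted in dim ≥ 3. [cite: Shimura1998, §14.3 Prop. 5, p. 104] -/
theorem not_exists_type_fortyFour_seven_sqrt_neg_one [IsCMField K] [IsCyclotomicExtension {44} ℚ K]
    (hζ : IsPrimitiveRoot ζ 44) (Φ : CMType K)
    (hbal : 2 * (SΦ[Φ, ζ] ∩ ({3, 7, 15, 19, 23, 27, 31, 35, 39, 43} : Finset (ZMod 44))).card = (SΦ[Φ, ζ]).card)
    {𝔣₀ : Ideal (𝓞 (maximalRealSubfield K))}
    (h𝔣₀ : 𝔣₀.map (algebraMap (𝓞 (maximalRealSubfield K)) (𝓞 K)) =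
      Ideal.span {(2 + hζ.toInteger ^ 11 * (1 + 2 * (hζ.toInteger ^ 4 + hζ.toInteger ^ 12 + hζ.toInteger ^ 16 +
        hζ.toInteger ^ 20 + hζ.toInteger ^ 36)) : 𝓞 K)}) :
    ¬ ∃ ζ' : K, IsCMField.complexConj K ζ' = -ζ' ∧ (∀ φ : Φ.1, 0 < (φ.1 ζ').im) ∧
        CMTypeLattice.IsOfType (1 : (FractionalIdeal (𝓞 K)⁰ K)ˣ) ζ' 𝔣₀ := by
  have hg : Nat.totient 44 = 2 * (9 + 1) := by decide
  obtain ⟨hA, hreal, h0⟩ := signSet_fortyFour_seven hζ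
  refine not_exists_type_of_norm_pos_of_odd' hζ hg hreal h0 (coe_surd_fortyFour hζ) hA Φ h𝔣₀
    (norm_realUnits_pos_fortyFour hζ) ?_
  rw [twistSetA_fortyFour]
  have hS := isCMTypeSet_residueFilter hζ Φ
  have hX : IsCMTypeSet 44 ({7, 15, 23, 25, 27, 31, 35, 39, 41, 43} : Finset (ZMod 44)) := by decide
  have hNK : IsCMTypeSet 44 ({3, 7, 15, 19, 23, 27, 31, 35, 39, 43} : Finset (ZMod 44)) := by decide
  have h1 := card_inter_mod_two_eq hS hX hNK
  have h2 := two_mul_card_eq_card_units hS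
  have hU : (Finset.univ.filter fun t : ZMod 44 => t.val.Coprime 44).card = 20 := by decide
  have h3 : (({7, 15, 23, 25, 27, 31, 35, 39, 41, 43} : Finset (ZMod 44)) \
      ({3, 7, 15, 19, 23, 27, 31, 35, 39, 43} : Finset (ZMod 44))).card = 2 := by decide
  rw [Nat.odd_iff]
  omega

end Summit.HodgeConjecture.Ring2WeilCoverage.SurdTypesLevel44

end
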